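/-
Copyright: width seat `ym-line-sll-p4` (prover-ym-line-sll-p4-g0-0), route `SoftLoopLongLag`, crux K′ `SoftLoopLagFloorToTorus`
(stmt-QuantumFields-22504), line `birth` — the E2 REDUCTION of the lead's E-architecture (card `Cruxes/ColdBoxSoftLoopLagFloor/Lines/birth.md`
v5, `Cruxes/SoftLoopLagFloorToTorus/Lines/birth.md` v3: K2 `stub_meanSmoothG` ⇐ E2 + in-box mixture for means).
-/
import Summits.QuantumFields.YangMills.Theorems.SoftLoopLongLagLoopTranslation
import Summits.QuantumFields.YangMills.Theorems.ColdBoxAllGroupsDefs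
import Literature.MathematicalPhysics.QuantumFieldTheory.BalabanBlockSpecification

/-!
# Route `SoftLoopLongLag`, crux K′ `SoftLoopLagFloorToTorus` (stmt-QuantumFields-22504), line `birth`: E2 (inner datum MEAN SMOOTHNESS of
# the soft-loop sum under the box kernel of `ColdBoxAllGroups`) REDUCED to the one-scale kernel mean expansion of ONE loop (N2-loops) —
# the loop analogue, every compact `G`, of the sibling's landed `goodBoundaryMeanSmoothG_of_expansion_explicit`

THE TARGET (E2 of the lead's E-architecture, WAKE-sll-p3 wave 3; it becomes the K2-side engine statement once the in-box mixture for
means carries it to the registered K2 `stub_meanSmoothG`).  In the cube geometry of the sibling route `ColdBoxAllGroups` (box kernel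
`γ′_ζ = boxKernelG r.ρ β H ζ` of `{0,…,2H}⁴`, `H = ⌈β^b⌉`), for the soft-loop sum translated to the centre,
`F_H = softLoopObs r R ∘ configShift (−boxCentre H)` (`R = ⌈β^ε⌉`), and every «good» datum `ζ`:
`|γ′_ζ(F_H ∘ α_R) − γ′_ζ(F_H)| ≤ K·R⁸·β^{2δ−1}/H` (`α_R = timeShiftLG R`; the lead's E2 has `2δ − 1 = κ − 1`, good = crude-good at
`κ/2` ∧ inner hot mass `≤ e^{−β^{κ/8}}`; here «good» is an arbitrary predicate `Good β ζ`, so the reduction serves any final typing).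

THE INTERFACE N2-loops (hypothesis `hexp`, typed in the sibling's currency = `KernelMeanExpansionG` of `Theorems/ColdBoxAllGroupsDefs.lean`
with the `(1,2)`-plaquette cost replaced by the COST OF ONE `R×R` LOOP): for `β ≥ β₀` and every good `ζ` there are one-colour Dirichlet data
`ϑ c` (`c < D = dimE r.ρ`) and competitors `s c` of total energy `Σ_c M_{ϑ c}(s c) ≤ CE·(2H+3)⁴·β^{2δ−1}` such that for EVERY base point `x`
with `‖x − boxCentre H‖ + R ≤ H/8`
  `|β·E_ζ[N − Re tr r(hol_{ℓ_x})] − (D/2)·V_D(x) − β·Σ_c Φ̄_c(x)²| ≤ β^{−b}`,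
where `ℓ_x = rectWalk x 1 2 R R`, `V_D(x) = Σ_{p,q ∈ S(x)} boxDirProjKernel H p q` is the Dirichlet variance of the loop flux (`S(x) = rectSurface x R R`)
and `Φ̄_c(x) = Σ_{p ∈ S(x)} F̄_c(p)` the background flux, `F̄_c = sCirc (glue (ϑ c) (mean (ϑ c)))` — at `R = 1` this IS `KernelMeanExpansionG`'s
clause.  (A POSIT to be proved by the loop port of the sibling's one-scale engine; not proved here, not a literature fact.)

THE REDUCTION `innerDatumMeanSmoothG_of_loopMeanExpansion` (this file, sorry-free): N2-loops ⇒ E2-shape with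
`K = 27·D·K_A + 33750·C²·|CE| + 108`, where `K_A` is the constant of the landed G-free N1′-loops
(`exists_abs_dirInductance_shift_sub_le`: the Dirichlet loop variance is translation-flat, `|V_D(x + Re₀) − V_D(x)| ≤ 2K_A R⁴/H⁴`) and `C` that of the
landed G-free background drift (`abs_backgroundFlux_sq_shift_sub_le`: `|Φ̄_c(x + Re₀)² − Φ̄_c(x)²| ≤ R·2R⁴C²E_c/H⁵`).  Proof = the sibling's telescoping,
one loop at a time: `F_H(α_R U) − F_H(U) = Σ_{z ∈ timeZeroCube R} (W_{ℓ_{z+c+Re₀}} − W_{ℓ_{z+c}})(U)` (translation covariance of rectangle holonomies,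
`walkHolonomy_configShift_rectWalk`), `N·W = N − cost`, and per loop `β·N·|ΔE W| ≤ (D/2)|ΔV_D| + β|ΔΣΦ̄²| + 2β^{−b}`; `(2R+1)³ ≤ 27R³` loops, thresholds
`β ≥ 1`, `H ≥ 32`, `24R ≤ H`.

HONEST LABEL: rung R2xi-G RECORD label (leaf `WeakCouplingRates.XiPow`, an UPPER bound on the lattice mass gap for every compact simple `G`); NOT
the Clay mass gap; no summit statement is touched.

References: the `SU(2)`/all-`G` plaquette instances `goodBoundaryMeanSmooth_of_expansion_explicit` / `goodBoundaryMeanSmoothG_of_expansion_explicit`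
(this tree); T. Balaban, CMP 89 (1983) §2 (background of small boundary data); H.-O. Georgii, *Gibbs Measures and Phase Transitions* (2011) §5.1
(translation covariance of specifications).
-/

set_option autoImplicit false

noncomputable section

open MeasureTheory Finset
open Literature.Probability.LatticeModels (Site box mem_box card_box)
open Literature.MathematicalPhysics.QuantumLattice
open Literature.MathematicalPhysics.QuantumFieldTheory
open Literature.MathematicalPhysics.QuantumFieldTheory.LatticeMaxwell
open Literature.MathematicalPhysics.QuantumFieldTheory.AxialGauge
open Literature.MathematicalPhysics.QuantumFieldTheory.LatticeChain
open Literature.MathematicalPhysics.QuantumFieldTheory.LatticeForm (d₁)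
open Summit.QuantumFields.YangMills.Theorems.WeakCouplingRates
open Summit.QuantumFields.YangMills.Theorems.FreeEnergyLogCoefficient (dimE)
open Summit.QuantumFields.YangMills.Theorems.ColdBoxAllGroups (boxKernelG)

namespace Summit.QuantumFields.YangMills.Theorems.SoftLoopLongLag

variable {G : Type} [Group G] [TopologicalSpace G] [IsTopologicalGroup G] [CompactSpace G]
  [MeasurableSpace G] [BorelSpace G]

/-! ## §3 The reduction E2 ⇐ N2-loops ∧ N1′-loops ∧ background drift -/

/-- **E2 ⇐ N2-loops** — inner datum mean smoothness of the soft-loop sum from the one-scale kernel mean expansion of one loop, every compact `G`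
(see the module docstring for the interface and the constants).  For exponents `0 ≤ ε < b`, `0 < δ` and any predicate `Good` of the datum: IF
for `β ≥ β₀` and every good `ζ` there are Dirichlet data `ϑ c` and competitors `s c` (`c < D = dimE r.ρ`) of total energy `≤ CE(2H+3)⁴β^{2δ−1}`
with `|β·E_ζ[N − Re tr r(hol_{ℓ_x})] − (D/2)·V_D(x) − β·Σ_c Φ̄_c(x)²| ≤ β^{−b}` at every base point `x` with `‖x − boxCentre H‖ + R ≤ H/8`
(`H = ⌈β^b⌉`, `R = ⌈β^ε⌉`), THEN there are `K`, `β₁` with, for `β ≥ β₁` and every good `ζ`,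
`|∫ F_H∘α_R dγ′_ζ − ∫ F_H dγ′_ζ| ≤ K·R⁸·β^{2δ−1}/H`, `F_H = softLoopObs r R ∘ configShift (−boxCentre H)`, `γ′_ζ = boxKernelG r.ρ β H ζ`. [folklore] -/
theorem innerDatumMeanSmoothG_of_loopMeanExpansion (r : LatticeRep G) {ε b δ : ℝ} (hε : 0 ≤ ε) (hεb : ε < b) (hδ : 0 < δ)
    (Good : ℝ → LGConfig 4 G → Prop)
    (hexp : ∃ CE : ℝ, ∃ β₀ : ℝ, ∀ β : ℝ, β₀ ≤ β → ∀ ζ : LGConfig 4 G, Good β ζ →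
      ∃ ϑ : Fin (dimE r.ρ) → (Literature.MathematicalPhysics.QuantumLattice.ZdEdge 4 → ℝ),
      ∃ s : Fin (dimE r.ρ) → (DirFree ⌈β ^ b⌉₊ → ℝ),
        (∑ c, formM (fun e => e ∉ dirFreeEdges ⌈β ^ b⌉₊) dirCorner (2 * ⌈β ^ b⌉₊ + 3) (ϑ c) (s c) ≤
            CE * (2 * (⌈β ^ b⌉₊ : ℝ) + 3) ^ 4 * β ^ (2 * δ - 1)) ∧
        ∀ x : Site 4, ‖x - boxCentre ⌈β ^ b⌉₊‖ + ⌈β ^ ε⌉₊ ≤ (⌈β ^ b⌉₊ : ℝ) / 8 →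
          |β * (∫ U, ((r.N : ℝ) - (r.ρ (walkHolonomy U (rectWalk x 1 2 ⌈β ^ ε⌉₊ ⌈β ^ ε⌉₊))).trace.re)
                ∂(boxKernelG r.ρ β ⌈β ^ b⌉₊ ζ)) -
              (dimE r.ρ : ℝ) / 2 * (∑ p ∈ rectSurface x ⌈β ^ ε⌉₊ ⌈β ^ ε⌉₊, ∑ q ∈ rectSurface x ⌈β ^ ε⌉₊ ⌈β ^ ε⌉₊,
                boxDirProjKernel ⌈β ^ b⌉₊ ((p.1, p.2.1.1, p.2.1.2) : Plaq 4) ((q.1, q.2.1.1, q.2.1.2) : Plaq 4)) -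
              β * ∑ c, (∑ p ∈ rectSurface x ⌈β ^ ε⌉₊ ⌈β ^ ε⌉₊,
                sCirc (LatticeMaxwell.glue (pin := fun e => e ∉ dirFreeEdges ⌈β ^ b⌉₊) dirCorner (2 * ⌈β ^ b⌉₊ + 3)
                  (ϑ c) (mean (fun e => e ∉ dirFreeEdges ⌈β ^ b⌉₊) dirCorner (2 * ⌈β ^ b⌉₊ + 3) (ϑ c)))
                  ((p.1, p.2.1.1, p.2.1.2) : Plaq 4)) ^ 2| ≤ β ^ (-b)) :
    ∃ K : ℝ, ∃ β₁ : ℝ, ∀ β : ℝ, β₁ ≤ β → ∀ ζ : LGConfig 4 G, Good β ζ →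
      |(∫ U, softLoopObs r ⌈β ^ ε⌉₊ (configShift (-(boxCentre ⌈β ^ b⌉₊)) (timeShiftLG (G := G) ⌈β ^ ε⌉₊ U))
          ∂(boxKernelG r.ρ β ⌈β ^ b⌉₊ ζ)) -
        (∫ U, softLoopObs r ⌈β ^ ε⌉₊ (configShift (-(boxCentre ⌈β ^ b⌉₊)) U) ∂(boxKernelG r.ρ β ⌈β ^ b⌉₊ ζ))|
        ≤ K * (⌈β ^ ε⌉₊ : ℝ) ^ 8 * β ^ (2 * δ - 1) / (⌈β ^ b⌉₊ : ℝ) := by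
  haveI : SecondCountableTopology G := r.secondCountableTopology
  obtain ⟨CE, β₀, hE⟩ := hexp
  obtain ⟨K_A, hKA0, hA⟩ := exists_abs_dirInductance_shift_sub_le
  obtain ⟨C, hC0, hB⟩ := abs_backgroundFlux_sq_shift_sub_le
  -- thresholds: `β ≥ β₀`, `β ≥ 1`, `β^b ≥ 32`, `48 β^ε ≤ β^b` (so that `24R ≤ H`)
  have hbε : 0 < b - ε := by linarith
  have hb : 0 < b := by linarith
  refine ⟨27 * (dimE r.ρ : ℝ) * K_A + 33750 * C ^ 2 * |CE| + 108,
    max (max β₀ 1) (max ((32 : ℝ) ^ (1 / b)) ((48 : ℝ) ^ (1 / (b - ε)))), fun β hβ ζ hζ => ?_⟩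
  have hβ₀ : β₀ ≤ β := le_trans (le_trans (le_max_left _ _) (le_max_left _ _)) hβ
  have hβ1 : (1 : ℝ) ≤ β := le_trans (le_trans (le_max_right _ _) (le_max_left _ _)) hβ
  have hβ0 : 0 < β := by linarith
  have h32 : (32 : ℝ) ≤ β ^ b :=
    le_rpow_of_root_le (by norm_num) hb (le_trans (le_trans (le_max_left _ _) (le_max_right _ _)) hβ)
  have h48 : (48 : ℝ) ≤ β ^ (b - ε) :=
    le_rpow_of_root_le (by norm_num) hbε (le_trans (le_trans (le_max_right _ _) (le_max_right _ _)) hβ)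
  set H : ℕ := ⌈β ^ b⌉₊ with hHdef
  set R : ℕ := ⌈β ^ ε⌉₊ with hRdef
  obtain ⟨hR1, hR2⟩ := one_le_ceil_rpow_and_le hβ1 hε
  obtain ⟨hH1, hH2⟩ := one_le_ceil_rpow_and_le hβ1 hb.le
  rw [← hRdef] at hR1 hR2
  rw [← hHdef] at hH1 hH2
  have hHceil : β ^ b ≤ (H : ℝ) := Nat.le_ceil _
  have hH32 : (32 : ℝ) ≤ H := h32.trans hHceil
  have hH8 : 8 ≤ H := by
    have : (8 : ℝ) ≤ H := by linarith
    exact_mod_cast this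
  have hHpos : (0 : ℝ) < H := by linarith
  have hR1n : 1 ≤ R := by exact_mod_cast hR1
  -- `24 R ≤ H`
  have h24R : 24 * (R : ℝ) ≤ H := by
    have h1 : 24 * (R : ℝ) ≤ 48 * β ^ ε := by linarith
    have h2 : (48 : ℝ) * β ^ ε ≤ β ^ b := by
      have : β ^ b = β ^ (b - ε) * β ^ ε := by rw [← Real.rpow_add hβ0]; ring_nf
      rw [this]
      exact mul_le_mul_of_nonneg_right h48 (Real.rpow_nonneg hβ0.le _)
    exact h1.trans (h2.trans hHceil)
  -- the expansion data for this `β`, `ζ`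
  obtain ⟨ϑ, s, henergy, hpt⟩ := hE β hβ₀ ζ hζ
  -- the kernel is a probability measure
  set γ : Measure (LGConfig 4 G) := boxKernelG r.ρ β H ζ with hγ
  haveI hγP : IsProbabilityMeasure γ := by
    rw [hγ]; unfold boxKernelG; exact isProbabilityMeasure_ymSpecification _ r.continuous β _ _
  set c : Site 4 := boxCentre H with hc
  -- energies
  have hEc0 : ∀ cc, 0 ≤ formM (fun e => e ∉ dirFreeEdges H) dirCorner (2 * H + 3) (ϑ cc) (s cc) := fun cc => by
    simp only [formM]; exact Finset.sum_nonneg fun p _ => sq_nonneg _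
  -- OPAQUE per-loop quantities (equations, not definitions: keeps unification cheap)
  obtain ⟨Em, hEm⟩ : ∃ Em : Site 4 → ℝ, ∀ x, Em x =
      ∫ U, wilsonLoopObs (fun g : G => (r.N : ℝ)⁻¹ * (r.ρ g).trace.re) (rectWalk x 1 2 R R) U ∂γ := ⟨_, fun _ => rfl⟩
  obtain ⟨Ecost, hEcost⟩ : ∃ Ecost : Site 4 → ℝ, ∀ x, Ecost x =
      ∫ U, ((r.N : ℝ) - (r.ρ (walkHolonomy U (rectWalk x 1 2 R R))).trace.re) ∂γ := ⟨_, fun _ => rfl⟩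
  obtain ⟨V, hV⟩ : ∃ V : Site 4 → ℝ, ∀ x, V x = ∑ p ∈ rectSurface x R R, ∑ q ∈ rectSurface x R R,
      boxDirProjKernel H ((p.1, p.2.1.1, p.2.1.2) : Plaq 4) ((q.1, q.2.1.1, q.2.1.2) : Plaq 4) := ⟨_, fun _ => rfl⟩
  obtain ⟨Φ, hΦ⟩ : ∃ Φ : Fin (dimE r.ρ) → Site 4 → ℝ, ∀ cc x, Φ cc x = ∑ p ∈ rectSurface x R R,
      sCirc (LatticeMaxwell.glue (pin := fun e => e ∉ dirFreeEdges H) dirCorner (2 * H + 3)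
        (ϑ cc) (mean (fun e => e ∉ dirFreeEdges H) dirCorner (2 * H + 3) (ϑ cc)))
        ((p.1, p.2.1.1, p.2.1.2) : Plaq 4) := ⟨_, fun _ _ => rfl⟩
  obtain ⟨Bk, hBk⟩ : ∃ Bk : Site 4 → ℝ, ∀ x, Bk x = ∑ cc, Φ cc x ^ 2 := ⟨_, fun _ => rfl⟩
  -- the expansion at a near-centre base point, in the opaque notation
  have hexp' : ∀ x : Site 4, ‖x - boxCentre H‖ + R ≤ (H : ℝ) / 8 →
      |β * Ecost x - (dimE r.ρ : ℝ) / 2 * V x - β * Bk x| ≤ β ^ (-b) := by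
    intro x hx
    rw [hEcost, hV, hBk]
    simp_rw [hΦ]
    exact hpt x hx
  -- STEP 1: the two integrals as sums of loop means
  have hsum0 : (∫ U, softLoopObs r R (configShift (-c) U) ∂γ) = ∑ z ∈ timeZeroCube R, Em (z + c) := by
    rw [integral_softLoopObs_configShift_neg]
    exact Finset.sum_congr rfl fun z _ => (hEm (z + c)).symm
  have hsumT : (∫ U, softLoopObs r R (configShift (-c) (timeShiftLG (G := G) R U)) ∂γ) =
      ∑ z ∈ timeZeroCube R, Em (z + c + Pi.single 0 (R : ℤ)) := by
    rw [integral_softLoopObs_configShift_neg_timeShiftLG]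
    exact Finset.sum_congr rfl fun z _ => (hEm _).symm
  -- geometry of the base points
  have hnear : ∀ z ∈ timeZeroCube R, ∀ i : ℕ, i ≤ R →
      ‖z + c + Pi.single 0 (i : ℤ) - boxCentre H‖ + R ≤ (H : ℝ) / 8 := by
    intro z hz i hi
    have h := norm_loopBase_sub_le hz c hi
    rw [hc] at h ⊢
    linarith
  have hnear0 : ∀ z ∈ timeZeroCube R, ‖z + c - boxCentre H‖ + R ≤ (H : ℝ) / 8 := by
    intro z hz
    have h := hnear z hz 0 (Nat.zero_le _)
    simpa using h
  -- common numerical facts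
  have hgeo : (2 * (H : ℝ) + 3) ^ 4 ≤ 625 * (H : ℝ) ^ 4 := two_mul_add_three_pow_four_le hH1
  have hβpow : 0 < β ^ (2 * δ - 1) := Real.rpow_pos_of_pos hβ0 _
  have hEsum' : ∑ cc, formM (fun e => e ∉ dirFreeEdges H) dirCorner (2 * H + 3) (ϑ cc) (s cc) ≤
      |CE| * (625 * (H : ℝ) ^ 4) * β ^ (2 * δ - 1) :=
    henergy.trans (mul_le_mul_of_nonneg_right
      ((mul_le_mul_of_nonneg_right (le_abs_self CE) (by positivity)).trans
        (mul_le_mul_of_nonneg_left hgeo (abs_nonneg CE))) hβpow.le)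
  have h2δ : β ^ (2 * δ) = β * β ^ (2 * δ - 1) := by
    rw [show 2 * δ = 1 + (2 * δ - 1) by ring, Real.rpow_add hβ0, Real.rpow_one]; ring_nf
  -- STEP 2: the per-loop estimate
  have hloop : ∀ z ∈ timeZeroCube R,
      |Em (z + c + Pi.single 0 (R : ℤ)) - Em (z + c)| ≤
        ((dimE r.ρ : ℝ) * K_A * (R : ℝ) ^ 4 / (H : ℝ) ^ 4 + 1250 * C ^ 2 * |CE| * ((R : ℝ) ^ 5 * β ^ (2 * δ)) / H +
          2 * β ^ (-b)) / β := by
    intro z hz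
    -- `N = 0`: the loop character vanishes identically
    rcases Nat.eq_zero_or_pos r.N with hN0 | hNpos
    · have hEm0 : ∀ x, Em x = 0 := fun x => by
        rw [hEm]
        have : ∀ U, wilsonLoopObs (fun g : G => (r.N : ℝ)⁻¹ * (r.ρ g).trace.re) (rectWalk x 1 2 R R) U = 0 := fun U => by
          simp only [wilsonLoopObs, hN0, Nat.cast_zero, inv_zero, zero_mul]
        simp_rw [this]
        exact integral_zero _ _
      rw [hEm0, hEm0, sub_zero, abs_zero]
      positivity
    -- `N ≥ 1`
    have hN1 : (1 : ℝ) ≤ r.N := by exact_mod_cast hNpos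
    set x₀ : Site 4 := z + c with hx₀
    set x₁ : Site 4 := z + c + Pi.single 0 (R : ℤ) with hx₁
    have hn0 : ‖x₀ - boxCentre H‖ + R ≤ (H : ℝ) / 8 := hnear0 z hz
    have hn1 : ‖x₁ - boxCentre H‖ + R ≤ (H : ℝ) / 8 := hnear z hz R le_rfl
    have e0 := hexp' x₀ hn0
    have e1 := hexp' x₁ hn1
    -- loop mean vs cost mean
    have hNE : ∀ x, (r.N : ℝ) * Em x = r.N - Ecost x := fun x => by
      rw [hEm, hEcost]; exact integral_wilsonLoopObs_eq_cost r hNpos x R R γ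
    -- N1′-loops: flat Dirichlet loop variance
    have hVd : |V x₁ - V x₀| ≤ 2 * K_A * (R : ℝ) ^ 4 / (H : ℝ) ^ 4 := by
      rw [hV, hV, hx₁, hx₀]
      exact hA H hH32 (z + c) (z + c) (Pi.single 0 (R : ℤ)) R (rectSurface_near_centre hn0) (rectSurface_near_centre hn0)
        (rectSurface_near_centre hn1) (rectSurface_near_centre hn1)
    -- background drift, colour by colour
    have hcol : ∀ cc, |Φ cc x₁ ^ 2 - Φ cc x₀ ^ 2| ≤
        (R : ℝ) * (2 * (R : ℝ) ^ 4 * C ^ 2 * formM (fun e => e ∉ dirFreeEdges H) dirCorner (2 * H + 3) (ϑ cc) (s cc) /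
          (H : ℝ) ^ 5) := by
      intro cc
      have hnear' : ∀ i : ℕ, i ≤ R → ∀ p ∈ rectSurface (x₀ + Pi.single 0 (i : ℤ)) R R, ‖p.1 - boxCentre H‖ ≤ (H : ℝ) / 8 :=
        fun i hi => rectSurface_near_centre (hnear z hz i hi)
      have h := hB H hH8 (ϑ cc) (s cc) x₀ R R hnear'
      rw [hΦ, hΦ, sum_rectSurface_sCirc_eq_d₁, sum_rectSurface_sCirc_eq_d₁, hx₁, hx₀]
      exact h
    have hBd : |Bk x₁ - Bk x₀| ≤ (R : ℝ) * (2 * (R : ℝ) ^ 4 * C ^ 2 *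
        (∑ cc, formM (fun e => e ∉ dirFreeEdges H) dirCorner (2 * H + 3) (ϑ cc) (s cc)) / (H : ℝ) ^ 5) := by
      rw [hBk, hBk, ← Finset.sum_sub_distrib]
      refine (Finset.abs_sum_le_sum_abs _ _).trans ((Finset.sum_le_sum fun cc _ => hcol cc).trans (le_of_eq ?_))
      rw [← Finset.mul_sum, ← Finset.sum_div, ← Finset.mul_sum]
    have hBd' : β * |Bk x₁ - Bk x₀| ≤ 1250 * C ^ 2 * |CE| * ((R : ℝ) ^ 5 * β ^ (2 * δ)) / H := by
      rw [h2δ]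
      calc β * |Bk x₁ - Bk x₀|
          ≤ β * ((R : ℝ) * (2 * (R : ℝ) ^ 4 * C ^ 2 *
              (∑ cc, formM (fun e => e ∉ dirFreeEdges H) dirCorner (2 * H + 3) (ϑ cc) (s cc)) / (H : ℝ) ^ 5)) :=
            mul_le_mul_of_nonneg_left hBd hβ0.le
        _ ≤ β * ((R : ℝ) * (2 * (R : ℝ) ^ 4 * C ^ 2 * (|CE| * (625 * (H : ℝ) ^ 4) * β ^ (2 * δ - 1)) / (H : ℝ) ^ 5)) := by
            gcongr
        _ = 1250 * C ^ 2 * |CE| * ((R : ℝ) ^ 5 * (β * β ^ (2 * δ - 1))) / H := by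
            field_simp
            ring
    -- assemble: `β·N·(Em₀ − Em₁) = [r₁] − [r₀] + (D/2)ΔV + βΔB`
    have hkey : β * ((r.N : ℝ) * (Em x₀ - Em x₁)) =
        (β * Ecost x₁ - (dimE r.ρ : ℝ) / 2 * V x₁ - β * Bk x₁) - (β * Ecost x₀ - (dimE r.ρ : ℝ) / 2 * V x₀ - β * Bk x₀) +
          (dimE r.ρ : ℝ) / 2 * (V x₁ - V x₀) + β * (Bk x₁ - Bk x₀) := by
      have : (r.N : ℝ) * (Em x₀ - Em x₁) = Ecost x₁ - Ecost x₀ := by rw [mul_sub, hNE, hNE]; ring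
      rw [this]; ring
    have hmain : β * ((r.N : ℝ) * |Em x₁ - Em x₀|) ≤
        (dimE r.ρ : ℝ) * K_A * (R : ℝ) ^ 4 / (H : ℝ) ^ 4 + 1250 * C ^ 2 * |CE| * ((R : ℝ) ^ 5 * β ^ (2 * δ)) / H +
          2 * β ^ (-b) := by
      have habs : β * ((r.N : ℝ) * |Em x₁ - Em x₀|) = |β * ((r.N : ℝ) * (Em x₀ - Em x₁))| := by
        rw [abs_mul, abs_mul, abs_of_pos hβ0, abs_of_nonneg (by positivity : (0 : ℝ) ≤ r.N), abs_sub_comm]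
      rw [habs, hkey]
      have hD2 : |(dimE r.ρ : ℝ) / 2 * (V x₁ - V x₀)| ≤ (dimE r.ρ : ℝ) * K_A * (R : ℝ) ^ 4 / (H : ℝ) ^ 4 := by
        rw [abs_mul, abs_of_nonneg (by positivity : (0 : ℝ) ≤ (dimE r.ρ : ℝ) / 2)]
        calc (dimE r.ρ : ℝ) / 2 * |V x₁ - V x₀| ≤ (dimE r.ρ : ℝ) / 2 * (2 * K_A * (R : ℝ) ^ 4 / (H : ℝ) ^ 4) :=
              mul_le_mul_of_nonneg_left hVd (by positivity)
          _ = (dimE r.ρ : ℝ) * K_A * (R : ℝ) ^ 4 / (H : ℝ) ^ 4 := by ring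
      have hβB : |β * (Bk x₁ - Bk x₀)| ≤ 1250 * C ^ 2 * |CE| * ((R : ℝ) ^ 5 * β ^ (2 * δ)) / H := by
        rw [abs_mul, abs_of_pos hβ0]; exact hBd'
      calc |(β * Ecost x₁ - (dimE r.ρ : ℝ) / 2 * V x₁ - β * Bk x₁) - (β * Ecost x₀ - (dimE r.ρ : ℝ) / 2 * V x₀ - β * Bk x₀) +
              (dimE r.ρ : ℝ) / 2 * (V x₁ - V x₀) + β * (Bk x₁ - Bk x₀)|
          ≤ |(β * Ecost x₁ - (dimE r.ρ : ℝ) / 2 * V x₁ - β * Bk x₁) - (β * Ecost x₀ - (dimE r.ρ : ℝ) / 2 * V x₀ - β * Bk x₀) +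
              (dimE r.ρ : ℝ) / 2 * (V x₁ - V x₀)| + |β * (Bk x₁ - Bk x₀)| := abs_add_le _ _
        _ ≤ (|(β * Ecost x₁ - (dimE r.ρ : ℝ) / 2 * V x₁ - β * Bk x₁) - (β * Ecost x₀ - (dimE r.ρ : ℝ) / 2 * V x₀ - β * Bk x₀)| +
              |(dimE r.ρ : ℝ) / 2 * (V x₁ - V x₀)|) + |β * (Bk x₁ - Bk x₀)| := by
            gcongr; exact abs_add_le _ _
        _ ≤ ((|β * Ecost x₁ - (dimE r.ρ : ℝ) / 2 * V x₁ - β * Bk x₁| + |β * Ecost x₀ - (dimE r.ρ : ℝ) / 2 * V x₀ - β * Bk x₀|) +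
              |(dimE r.ρ : ℝ) / 2 * (V x₁ - V x₀)|) + |β * (Bk x₁ - Bk x₀)| := by
            gcongr; exact abs_sub _ _
        _ ≤ ((β ^ (-b) + β ^ (-b)) + (dimE r.ρ : ℝ) * K_A * (R : ℝ) ^ 4 / (H : ℝ) ^ 4) +
              1250 * C ^ 2 * |CE| * ((R : ℝ) ^ 5 * β ^ (2 * δ)) / H := by
            gcongr
        _ = (dimE r.ρ : ℝ) * K_A * (R : ℝ) ^ 4 / (H : ℝ) ^ 4 + 1250 * C ^ 2 * |CE| * ((R : ℝ) ^ 5 * β ^ (2 * δ)) / H +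
              2 * β ^ (-b) := by ring
    -- divide by `β·N ≥ β`
    rw [le_div_iff₀ hβ0]
    calc |Em x₁ - Em x₀| * β = β * (1 * |Em x₁ - Em x₀|) := by ring
      _ ≤ β * ((r.N : ℝ) * |Em x₁ - Em x₀|) :=
          mul_le_mul_of_nonneg_left (mul_le_mul_of_nonneg_right hN1 (abs_nonneg _)) hβ0.le
      _ ≤ _ := hmain
  -- STEP 3: sum over the `≤ 27R³` loops and simplify the rates
  have hcard := card_timeZeroCube_le_real hR1n
  rw [hsumT, hsum0, ← Finset.sum_sub_distrib]
  refine (Finset.abs_sum_le_sum_abs _ _).trans ((Finset.sum_le_card_nsmul _ _ _ hloop).trans ?_)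
  rw [nsmul_eq_mul]
  -- the common rate `Q = R⁵ β^{2δ−1} / H`
  obtain ⟨Q, hQ⟩ : ∃ Q : ℝ, Q = (R : ℝ) ^ 5 * β ^ (2 * δ - 1) / H := ⟨_, rfl⟩
  have hQ0 : 0 ≤ Q := by rw [hQ]; positivity
  have hβm1 : β⁻¹ ≤ β ^ (2 * δ - 1) := by
    rw [← Real.rpow_neg_one]
    exact Real.rpow_le_rpow_of_exponent_le hβ1 (by linarith)
  have hR1r : (1 : ℝ) ≤ R := by exact_mod_cast hR1n
  have hR45 : (R : ℝ) ^ 4 ≤ (R : ℝ) ^ 5 := pow_le_pow_right₀ hR1r (by norm_num)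
  have hH4 : (H : ℝ) ≤ (H : ℝ) ^ 4 := le_self_pow₀ hH1 (by norm_num)
  -- term 1: `D K_A R⁴/(H⁴ β) ≤ D K_A · Q`
  have hT1 : (dimE r.ρ : ℝ) * K_A * (R : ℝ) ^ 4 / (H : ℝ) ^ 4 / β ≤ (dimE r.ρ : ℝ) * K_A * Q := by
    have h1 : (dimE r.ρ : ℝ) * K_A * (R : ℝ) ^ 4 / (H : ℝ) ^ 4 / β =
        (dimE r.ρ : ℝ) * K_A * ((R : ℝ) ^ 4 * β⁻¹ / (H : ℝ) ^ 4) := by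
      field_simp
    rw [h1, hQ]
    refine mul_le_mul_of_nonneg_left ?_ (by positivity)
    calc (R : ℝ) ^ 4 * β⁻¹ / (H : ℝ) ^ 4 ≤ (R : ℝ) ^ 5 * β ^ (2 * δ - 1) / (H : ℝ) ^ 4 := by gcongr
      _ ≤ (R : ℝ) ^ 5 * β ^ (2 * δ - 1) / H := div_le_div_of_nonneg_left (by positivity) hHpos hH4
  -- term 2: `1250 C² |CE| R⁵ β^{2δ}/(H β) = 1250 C² |CE| · Q`
  have hT2 : 1250 * C ^ 2 * |CE| * ((R : ℝ) ^ 5 * β ^ (2 * δ)) / H / β = 1250 * C ^ 2 * |CE| * Q := by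
    rw [hQ, h2δ]
    field_simp
  -- term 3: `2β^{-b}/β ≤ 4·Q` since `β^{-b}·H ≤ 2`
  have hT3 : 2 * β ^ (-b) / β ≤ 4 * Q := by
    have h1 : β ^ (-b) * (H : ℝ) ≤ 2 := by
      calc β ^ (-b) * (H : ℝ) ≤ β ^ (-b) * (2 * β ^ b) := mul_le_mul_of_nonneg_left hH2 (Real.rpow_nonneg hβ0.le _)
        _ = 2 * (β ^ (-b) * β ^ b) := by ring
        _ = 2 := by rw [← Real.rpow_add hβ0, neg_add_cancel, Real.rpow_zero, mul_one]
    have h2 : 2 * β ^ (-b) / β ≤ 4 * (β⁻¹ / H) := by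
      rw [div_eq_mul_inv (2 * β ^ (-b)) β, show 4 * (β⁻¹ / (H : ℝ)) = (4 / H) * β⁻¹ by ring]
      refine mul_le_mul_of_nonneg_right ?_ (by positivity)
      rw [le_div_iff₀ hHpos]
      linarith
    have h3 : β⁻¹ / (H : ℝ) ≤ Q := by
      rw [hQ]
      refine div_le_div_of_nonneg_right ?_ hHpos.le
      calc β⁻¹ ≤ β ^ (2 * δ - 1) := hβm1
        _ = 1 * β ^ (2 * δ - 1) := (one_mul _).symm
        _ ≤ (R : ℝ) ^ 5 * β ^ (2 * δ - 1) := mul_le_mul_of_nonneg_right (one_le_pow₀ hR1r) hβpow.le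
    linarith
  -- per loop: `P/β ≤ (D K_A + 1250 C²|CE| + 4)·Q`
  have hP : ((dimE r.ρ : ℝ) * K_A * (R : ℝ) ^ 4 / (H : ℝ) ^ 4 + 1250 * C ^ 2 * |CE| * ((R : ℝ) ^ 5 * β ^ (2 * δ)) / H +
        2 * β ^ (-b)) / β ≤ ((dimE r.ρ : ℝ) * K_A + 1250 * C ^ 2 * |CE| + 4) * Q := by
    rw [add_div, add_div, hT2]
    linarith
  have hP0 : 0 ≤ ((dimE r.ρ : ℝ) * K_A * (R : ℝ) ^ 4 / (H : ℝ) ^ 4 + 1250 * C ^ 2 * |CE| * ((R : ℝ) ^ 5 * β ^ (2 * δ)) / H +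
      2 * β ^ (-b)) / β := by positivity
  calc ((timeZeroCube R).card : ℝ) * (((dimE r.ρ : ℝ) * K_A * (R : ℝ) ^ 4 / (H : ℝ) ^ 4 +
          1250 * C ^ 2 * |CE| * ((R : ℝ) ^ 5 * β ^ (2 * δ)) / H + 2 * β ^ (-b)) / β)
      ≤ (27 * (R : ℝ) ^ 3) * (((dimE r.ρ : ℝ) * K_A + 1250 * C ^ 2 * |CE| + 4) * Q) :=
        mul_le_mul hcard hP hP0 (by positivity)
    _ = (27 * (dimE r.ρ : ℝ) * K_A + 33750 * C ^ 2 * |CE| + 108) * (R : ℝ) ^ 8 * β ^ (2 * δ - 1) / (H : ℝ) := by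
        rw [hQ]
        field_simp
        ring

end Summit.QuantumFields.YangMills.Theorems.SoftLoopLongLag

end
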